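import Mathlib
import Literature.Barriers.ValiantsHypothesis.AlgebraicNaturalProofs
import Literature.Computability.AlgebraicComplexity.ArithCircuitProofs
import Summits.ValiantsHypothesis.ValiantsHypothesis.Theorems.BarrierLeverPartitionMinorsHitByVPCellDoorPotentials

/-!
# Route BarrierLever — item `PartitionMinorsHitByVP` (stmt-ValiantsHypothesis-19717):
# the SEMI-STRICT cell door — ties allowed in opposite directions on the two sides (block-triangular
# tight matrix)

Helper file (`--supports stmt-ValiantsHypothesis-19717`; cell valiant-natproofs, rung V4, 𝒟-side,
prover seat val-np-p6 gen 2). Definition-free, outside the theses cone. Closes NO item.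

The cell door `…StrataDoor.partitionMinor_hit_of_cells` (p475102) asks that row `i` be the STRICT
argmax of the row scores at `t = lv i` and column `j` the strict argmax of the column scores at
`t = lv j`; the tight matrix of the potential door (`…partitionMinor_hit_of_potentials`, p474773) is
then block-DIAGONAL. The potential door allows more: if rows may TIE with later cells (`ρ_t(i) ≤ ρ_{lv i}(i)`
with strict inequality only for `t < lv i`) and columns may tie with earlier cells (`κ_t(j) ≤ κ_{lv j}(j)`,
strict only for `t > lv j`), a summand `t` is tight at `(i, j)` only if `lv i ≤ t ≤ lv j`; so the tight
matrix is block-UPPER-TRIANGULAR with the cell matrices on the diagonal (`Matrix.BlockTriangular.det`),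
and nonsingular cells still suffice. This is the one-sidedly CLOSED version of the power-diagram cells
(rows on a common boundary of cells `s < t` may be put into `s`, columns into `t`), the analogue for
cells of choosing the closed end of each threshold interval independently on the two sides.

* `det_ne_zero_of_blockTriangular_levels` — a matrix vanishing below the diagonal blocks of `lv` is
  nonsingular if its diagonal blocks are.
* **`partitionMinor_hit_of_cells_semistrict`** — the door (ι-indexed; size `≤ Σ_t L(F t) + m(2h+2)`,
  degree `≤ max_t deg (F t)`).

WHAT THIS IS NOT: a variant of the gluing step; nothing on which layouts admit poly-cell certificates,
on TT / item 19616 / 19761, on crux 14610 or on VP vs VNP.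
-/

set_option linter.dupNamespace false

namespace Summit.ValiantsHypothesis.ValiantsHypothesis.Theorems.BarrierLever.StrataDoor

open Finset
open Literature.Barriers.ValiantsHypothesis Literature.Computability.AlgebraicComplexity

/-- A matrix vanishing BELOW the diagonal blocks of `lv` (`lv j < lv i ⇒ B i j = 0`) is nonsingular
if its diagonal blocks are. -/
theorem det_ne_zero_of_blockTriangular_levels {ι : Type*} [Fintype ι] [DecidableEq ι]
    (B : Matrix ι ι ℂ) (lv : ι → ℕ) (hoff : ∀ i j, lv j < lv i → B i j = 0)
    (hblk : ∀ t ∈ (Finset.univ : Finset ι).image lv,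
      (Matrix.of fun i j : {i // lv i = t} => B i.1 j.1).det ≠ 0) :
    B.det ≠ 0 := by
  have hBT : B.BlockTriangular lv := fun i j hij => hoff i j hij
  rw [hBT.det]
  exact Finset.prod_ne_zero_iff.mpr fun t ht => by
    rw [Matrix.toSquareBlock_def]
    exact hblk t ht

/-- **The semi-strict cell door.** Rows and columns indexed by `ι`, cells `lv i < m`. Row scores
`kr t + Σ_{a ∈ u i} lam t a` are maximal at `t = lv i`, STRICTLY larger than the scores of EARLIER cells
`t < lv i` (ties with later cells allowed); column scores `kc t + Σ_{c ∈ w j} mu t c` are maximal at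
`t = lv j`, strictly larger than the scores of LATER cells `t > lv j` (ties with earlier cells
allowed). If every cell matrix is nonsingular, some `f` of size `≤ Σ_{t<m} L(F t) + m(2h+2)` and degree
`≤ max_t deg(F t)` has a nonsingular layout matrix on `(u, w)`. -/
theorem partitionMinor_hit_of_cells_semistrict {ι : Type*} [Fintype ι] [DecidableEq ι] (h m : ℕ)
    (u w : ι → Finset (Fin h)) (lam mu : ℕ → Fin h → ℤ) (kr kc : ℕ → ℤ) (lv : ι → ℕ)
    (hlv : ∀ i, lv i < m)
    (hrow_le : ∀ i, ∀ t < m, kr t + ∑ a ∈ u i, lam t a ≤ kr (lv i) + ∑ a ∈ u i, lam (lv i) a)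
    (hrow_lt : ∀ i, ∀ t < m, t < lv i →
      kr t + ∑ a ∈ u i, lam t a < kr (lv i) + ∑ a ∈ u i, lam (lv i) a)
    (hcol_le : ∀ j, ∀ t < m, kc t + ∑ c ∈ w j, mu t c ≤ kc (lv j) + ∑ c ∈ w j, mu (lv j) c)
    (hcol_lt : ∀ j, ∀ t < m, lv j < t →
      kc t + ∑ c ∈ w j, mu t c < kc (lv j) + ∑ c ∈ w j, mu (lv j) c)
    (F : ℕ → MvPolynomial (Fin (h + h)) ℂ)
    (hdet : ∀ t < m, (Matrix.of fun i j : {i // lv i = t} => MvPolynomial.coeff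
        (∑ a ∈ u i.1, Finsupp.single (Fin.castAdd h a) 1 +
          ∑ c ∈ w j.1, Finsupp.single (Fin.natAdd h c) 1) (F t)).det ≠ 0) :
    ∃ f : MvPolynomial (Fin (h + h)) ℂ,
      f.totalDegree ≤ (Finset.range m).sup (fun t => (F t).totalDegree) ∧
      complexity f ≤ ∑ t ∈ Finset.range m, complexity (F t) + m * (h + h + 2) ∧
      (Matrix.of fun i j : ι => MvPolynomial.coeff
        (∑ a ∈ u i, Finsupp.single (Fin.castAdd h a) 1 +
          ∑ c ∈ w j, Finsupp.single (Fin.natAdd h c) 1) f).det ≠ 0 := by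
  classical
  set R : ℕ → ι → ℤ := fun t i => kr t + ∑ a ∈ u i, lam t a with hR
  set Cx : ℕ → ι → ℤ := fun t j => kc t + ∑ c ∈ w j, mu t c with hCx
  refine partitionMinor_hit_of_potentials h m u w lam mu kr kc (fun i => R (lv i) i)
    (fun j => Cx (lv j) j) (fun t ht i j => ?_) F ?_
  · have h1 := hrow_le i t ht
    have h2 := hcol_le j t ht
    simp only [hR, hCx] at h1 h2 ⊢
    linarith
  · -- tightness forces `lv i ≤ t ≤ lv j`; on the diagonal blocks only `t = lv i = lv j` is tight
    have htight_le : ∀ t < m, ∀ i j : ι,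
        kr t + ∑ a ∈ u i, lam t a + (kc t + ∑ c ∈ w j, mu t c) = R (lv i) i + Cx (lv j) j →
          lv i ≤ t ∧ t ≤ lv j := by
      intro t ht i j hh
      constructor
      · by_contra hne
        have := hrow_lt i t ht (by omega)
        have h2 := hcol_le j t ht
        simp only [hR, hCx] at this h2 hh
        linarith
      · by_contra hne
        have := hcol_lt j t ht (by omega)
        have h2 := hrow_le i t ht
        simp only [hR, hCx] at this h2 hh
        linarith
    set N : Matrix ι ι ℂ := Matrix.of fun i j : ι => ∑ t ∈ Finset.range m,
        (if kr t + ∑ a ∈ u i, lam t a + (kc t + ∑ c ∈ w j, mu t c) = R (lv i) i + Cx (lv j) j then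
          MvPolynomial.coeff (∑ a ∈ u i, Finsupp.single (Fin.castAdd h a) 1 +
            ∑ c ∈ w j, Finsupp.single (Fin.natAdd h c) 1) (F t) else 0) with hN
    have hNoff : ∀ i j, lv j < lv i → N i j = 0 := by
      intro i j hij
      simp only [hN, Matrix.of_apply]
      refine Finset.sum_eq_zero fun t ht => ?_
      rw [if_neg]
      intro hh
      obtain ⟨h1, h2⟩ := htight_le t (Finset.mem_range.mp ht) i j hh
      omega
    have hNdiag : ∀ i j, lv i = lv j → N i j = MvPolynomial.coeff
        (∑ a ∈ u i, Finsupp.single (Fin.castAdd h a) 1 +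
          ∑ c ∈ w j, Finsupp.single (Fin.natAdd h c) 1) (F (lv i)) := by
      intro i j hij
      simp only [hN, Matrix.of_apply]
      rw [Finset.sum_eq_single (lv i)]
      · rw [if_pos]
        simp only [hR, hCx, hij]
      · intro t ht hne
        rw [if_neg]
        intro hh
        obtain ⟨h1, h2⟩ := htight_le t (Finset.mem_range.mp ht) i j hh
        omega
      · intro hh
        exact absurd (Finset.mem_range.mpr (hlv i)) hh
    show N.det ≠ 0
    refine det_ne_zero_of_blockTriangular_levels N lv hNoff (fun t ht => ?_)
    obtain ⟨i₀, -, hi₀⟩ := Finset.mem_image.mp ht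
    have htm : t < m := hi₀ ▸ hlv i₀
    have hblk : (Matrix.of fun i j : {i // lv i = t} => N i.1 j.1) =
        Matrix.of fun i j : {i // lv i = t} => MvPolynomial.coeff
          (∑ a ∈ u i.1, Finsupp.single (Fin.castAdd h a) 1 +
            ∑ c ∈ w j.1, Finsupp.single (Fin.natAdd h c) 1) (F t) := by
      ext i j
      rw [Matrix.of_apply, Matrix.of_apply, hNdiag i.1 j.1 (i.2.trans j.2.symm), i.2]
    rw [hblk]
    exact hdet t htm

end Summit.ValiantsHypothesis.ValiantsHypothesis.Theorems.BarrierLever.StrataDoor
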